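import Literature.MathematicalPhysics.QuantumFieldTheory.Balaban1983to89.B9LettersZQstarFieldsAtPinsR
import Literature.MathematicalPhysics.QuantumFieldTheory.Balaban1983to89.B9BackgroundsKLevelV1R
import Literature.MathematicalPhysics.QuantumFieldTheory.Balaban1983to89.Node00.OpsYRecordV4P
import Literature.MathematicalPhysics.QuantumFieldTheory.Balaban1983to89.B9LettersZSchemasMono
import Literature.MathematicalPhysics.QuantumFieldTheory.Balaban1983to89.B9LettersHZAtOne

/-!
# BalabanUVNodes ∕ N06 ([B9], `Dag.B9_main`) — CASCADE-K PIECE K2 (director-ym №383): THE `∇_{U,ν}G₀Q\*` AND `Φ^X_β∇_{U,ν}G₀Q\*` FAMILIES OF `…N06G0QstarLettersLegAtPinsPU`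
# RE-PRESSED WITH THE AVERAGING LETTER's `Q⋆`-MAJORANT DISPLAYED AS A LAW (the straight-pair pin `hQsco12 : Q⋆ = QscoKH … parBY …` REMOVED)

Track A of `YM-PLAN.md` (cell `pub-ymgap`, HUMAN RULING D-0062), node **N06** = [Balaban1985BackgroundPropagators] Thms 3.1–3.15; bundle F7 rows 20–21, seat
`pub-ymgap-dag-n06-l` (g36).  A HELPER for dag-n06-d's knit certificate skeleton «K» (K3).
WHY.  `g0qstar_letters_of_pins` (✓, this lineage g30) composes the G₀ layer's directional letters with the LOCAL letter of `Q\*` read off the PIN `hQsco12 : (𝔬12 x).Qstar U =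
QscoKH … (parBY x.toKIdx) …` — the coordinates of def-Y's straight-contour `Q*(U)` (dag-n06-w5's `hasMaj_Qstar_of_pins`).  At the knit certificate the averaging letter is print's
knit letter `qKnitOfRecord` ∕ its adjoint (dag-n06-d ⚑ LOCATED-K: the pin is one of the 46 rows keyed to the straight pair).  This file is the parametric re-press in the shape
of dag-n06-d's `…N06HHLegAtPinsPhysRUPar.hLHH_of_pinsRU_par`: the pin package `bI hβ1 hblk12 hblkZ12 hQsco12 hGR` is REPLACED by ONE displayed law — the `Q⋆`-majorant
`hqsK : … Reg335 → HasMaj (weightNorm 𝔠_Z plateau) (cNorm 1 H blk 0) ((𝔬12 x).Qstar U) (BQ·e^{−δQ d})` with `BQ ≥ 0`, `δQ ≥ δ12₃ + σ12` — and the engines are this lineage's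
generic composition theorems `B9Thm313WholeQstarFromG0.dgQs_of_e1 ∕ pQ_of_h43` called VERBATIM.  Instances: the straight pair (law by `hasMaj_Qstar_of_pins`, `BQ = e^{δQ(ℓ+4)}`)
recovers the landed theorem; the knit letter's law = dag-n06-c's (L7) sizes of `Q†` (cf. `qLawsY_qKnitOfRecord`).
★★★ `g0qstar_letters_of_laws`.  HONEST FRAMING.  Mechanical re-press; the G₀-layer letters and the `Q⋆`-majorant are HYPOTHESES; COUNT-NEUTRAL; nothing of [B9]'s propagator
estimates asserted; N06 NOT discharged; K1 NOT closed; one finite 𝕋⁴ programme at fixed `ε` — NOT continuum, NOT OS, NOT the mass gap ∕ Clay.  0 `def`, 0 `sorry`.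
[cite: Balaban1985BackgroundPropagators, Thm 3.12 pp.421–423, Thm 3.13 p.426, (3.126) p.420, (3.42)–(3.43) pp.397–398, (3.13) p.393, (3.115) p.418;
Balaban1984PropagatorsII, (2.52)–(2.56) pp.232–233, Lemma 2.1 (2.61) p.234; Balaban1985Averaging, (15) p.19]
-/

noncomputable section

namespace Summit.QuantumFields.YangMills.BalabanUVNodes.N06G0QstarLettersLegAtPinsPUPar

open scoped Matrix.Norms.L2Operator
open Literature.MathematicalPhysics.QuantumFieldTheory.Balaban1983to89
open Literature.MathematicalPhysics.QuantumFieldTheory.Balaban1983to89.Node00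
open Literature.MathematicalPhysics.QuantumFieldTheory.Balaban1983to89.B9PinMembersKLevelV1 (MemberY geo9Y bg9Y)
open Literature.MathematicalPhysics.QuantumFieldTheory.Balaban1983to89.B9BackgroundsKLevelV1R (RegFamY bg9YR MemOfFam mem_of_reg335R)
open Literature.MathematicalPhysics.QuantumFieldTheory.Balaban1983to89.B7Prop2SpecialUnitary (specialUnitaryUnits)
open Literature.MathematicalPhysics.QuantumFieldTheory.Balaban1983to89.B6GlobalChartV1 (blkV1)
open Literature.MathematicalPhysics.QuantumFieldTheory.Balaban1983to89.B6Ineq2142KLevelV1 (β lvl)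
open Literature.MathematicalPhysics.QuantumFieldTheory.Balaban1983to89.B6Geom246MultiLevelTorus (geomT)
open Literature.MathematicalPhysics.QuantumFieldTheory.Balaban1983to89.B6RandomWalkHom (HasMajorantHom)
open Literature.MathematicalPhysics.QuantumFieldTheory.Balaban1983to89.B9CoReadingCoordsTranspose (TrIdx trBasis)
open Literature.MathematicalPhysics.QuantumFieldTheory.Balaban1983to89.B9CoReadingCoords (XBK blkBK)
open Literature.MathematicalPhysics.QuantumFieldTheory.Balaban1983to89.B9CoReadingCoordsH (XHK blkHK)
open Literature.MathematicalPhysics.QuantumFieldTheory.Balaban1983to89.B9GeoNormsKLevelV1 (geo9K geo9K_dist_nonneg)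
open Literature.MathematicalPhysics.QuantumFieldTheory.Balaban1983to89.B9GeoLemma21KLevelV1 (geo9Y_dist_triangle geo9Y_dist_comm geo9Y_len_pos rowSum261_geo9Y)
open Literature.MathematicalPhysics.QuantumFieldTheory.Balaban1983to89.B9Thm34Ext (toB6)
open Literature.MathematicalPhysics.QuantumFieldTheory.Balaban1983to89.B9SectDSup (weightNorm)
open Literature.MathematicalPhysics.QuantumFieldTheory.Balaban1983to89.B11SectG (HasMaj BlockNorm RowSum)
open Literature.MathematicalPhysics.QuantumFieldTheory.Balaban1983to89.B9Thm312Whole (Ops GeoOK cNorm)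
open Literature.MathematicalPhysics.QuantumFieldTheory.Balaban1983to89.B9Thm312WholeClasses (cNormR)
open Literature.MathematicalPhysics.QuantumFieldTheory.Balaban1983to89.B9RWSums343Holder (HolderProbes)
open Literature.MathematicalPhysics.QuantumFieldTheory.Balaban1983to89.B9LettersHZAtOne (plateau_pos)
open Literature.MathematicalPhysics.QuantumFieldTheory.Balaban1983to89.Node00.OpsYSectDCoords (QscoKH)
open Literature.MathematicalPhysics.QuantumFieldTheory.Balaban1983to89.B9Thm313WholeQstarFromG0 (dgQs_of_e1 pQ_of_h43)
open Literature.MathematicalPhysics.QuantumFieldTheory.Balaban1983to89.B6RandomWalkHom (HasMajorantHom)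

variable {N : ℕ}

/-- ★★★ **`∇_{U,ν}G₀Q\*` AND `Φ^X_β∇_{U,ν}G₀Q\*` FROM THE G₀ LAYER AND A DISPLAYED `Q⋆`-MAJORANT, MEMBER-UNIFORMLY** (module docstring): from the directional letters
`e1d ∕ h43d` of ∇_{U,ν}G₀ at (B12₀ ∕ Bh12, δ12₀) and the law `hqsK` (`Q⋆ : 𝔠⁽⁰⁾ → Z` with majorant `BQ·e^{−δQ d}`, `δQ ≥ δ12₃ + σ12`), ONE `obtain` gives `Md ≥ M12`, `Bd ≥ 0`,
`Bq ≥ 0` and the certificate's families `hdgQsd ∕ hpQd` at rate δ12₃ (`Bd := B12₀·BQ·c`, `Bq β := max (Bh12 β) 0·BQ·c`, `c` the [4] (2.61) row constant at rate σ12).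
[cite: Balaban1985BackgroundPropagators, Thm 3.12 pp.421–423, Thm 3.13 p.426, (3.126) p.420, (3.42)–(3.43) pp.397–398, (3.13) p.393; Balaban1984PropagatorsII, (2.52)–(2.56) pp.232–233, Lemma 2.1 (2.61) p.234] -/
theorem g0qstar_letters_of_laws (θ : Stage3Params) (Mstar : ℕ) {R₁ R₂ : RegFamY θ.d₆ θ.ℓ₆ θ.hd' θ.hL' θ.b₀ θ.b₁ Mstar (Matrix (Fin N) (Fin N) ℂ)} {c : ℝ}
    [∀ x : MemberY θ.d₆ θ.ℓ₆ θ.hd' θ.hL' θ.b₀ θ.b₁ Mstar, Fintype (geo9Y x).Site]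
    (H12 : MemberY θ.d₆ θ.ℓ₆ θ.hd' θ.hL' θ.b₀ θ.b₁ Mstar → Prop) {W12 PX PY : MemberY θ.d₆ θ.ℓ₆ θ.hd' θ.hL' θ.b₀ θ.b₁ Mstar → Type} [∀ x, Fintype (W12 x)] [∀ x, Fintype (PX x)] [∀ x, Fintype (PY x)]
    (𝔬12 : ∀ x : MemberY θ.d₆ θ.ℓ₆ θ.hd' θ.hL' θ.b₀ θ.b₁ Mstar, B9Thm312Whole.Ops (geo9Y x) (bg9YR (Matrix (Fin N) (Fin N) ℂ) (specialUnitaryUnits (Fin N)) R₁ R₂ x) (XBK (TrIdx N) x.toKIdx) (XBK (TrIdx N) x.toKIdx) (XHK (TrIdx N) x.toKIdx) (W12 x))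
    (𝔭A : ∀ x : MemberY θ.d₆ θ.ℓ₆ θ.hd' θ.hL' θ.b₀ θ.b₁ Mstar, HolderProbes (geo9Y x) (bg9YR (Matrix (Fin N) (Fin N) ℂ) (specialUnitaryUnits (Fin N)) R₁ R₂ x) (XBK (TrIdx N) x.toKIdx) (XBK (TrIdx N) x.toKIdx) (PX x) (PY x))
    (Dd : ∀ x : MemberY θ.d₆ θ.ℓ₆ θ.hd' θ.hL' θ.b₀ θ.b₁ Mstar, (bg9YR (Matrix (Fin N) (Fin N) ℂ) (specialUnitaryUnits (Fin N)) R₁ R₂ x).Cfg → Fin (θ.d₆ + 1) → Module.End ℝ (XBK (TrIdx N) x.toKIdx → ℝ))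
    {M12 a12 B12₀ δ12₀ δ12₃ σ12 : ℝ} {Bh12 : ℝ → ℝ} (hB12₀ : 0 ≤ B12₀) (hBh12 : ∀ β, 0 ≤ β → β < 1 → 0 ≤ Bh12 β) (hσ12 : 0 < σ12)
    (hδ30 : 0 ≤ δ12₃) (hδ₃₀ : δ12₃ ≤ δ12₀)
    -- [CASCADE-K K2] THE AVERAGING LETTER's `Q⋆`-MAJORANT AT THE MEMBER, DISPLAYED (today: dag-n06-w5's `hasMaj_Qstar_of_pins` at the straight pair, `BQ = e^{δQ(ℓ+4)}`; knit: dag-n06-c's (L7) sizes of `Q†`) — rate `δQ ≥ δ12₃ + σ12`, constant `BQ ≥ 0`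
    (BQ δQ : ℝ) (hBQ : 0 ≤ BQ) (hδQ : δ12₃ + σ12 ≤ δQ)
    (hqsK : ∀ x : MemberY θ.d₆ θ.ℓ₆ θ.hd' θ.hL' θ.b₀ θ.b₁ Mstar, M12 ≤ (geo9Y x).M → ∀ α₀ : ℝ, 0 < α₀ → (geo9Y x).M * α₀ ≤ a12 →
      ∀ U : (bg9YR (Matrix (Fin N) (Fin N) ℂ) (specialUnitaryUnits (Fin N)) R₁ R₂ x).Cfg, (bg9YR (Matrix (Fin N) (Fin N) ℂ) (specialUnitaryUnits (Fin N)) R₁ R₂ x).Reg335 c α₀ U →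
        HasMaj (weightNorm (BlockNorm.ofBlocks (toB6 (geo9Y x) 1 (H12 x)) (𝔬12 x).blkZ) (fun y => ((((θ.ℓ₆ + 1 : ℕ) : ℝ) ^ (θ.d₆ + 1)) ^ lvl x.hN x.D x.hk y)⁻¹) (fun y => (plateau_pos x.toKIdx y).le))
          (cNorm 1 (H12 x) (𝔬12 x).blk (fun y => (geo9Y_len_pos x y).le) 0) ((𝔬12 x).Qstar U) (fun a a' => BQ * Real.exp (-(δQ * (geo9Y x).dist a a'))))
    (he1d : ∀ x : MemberY θ.d₆ θ.ℓ₆ θ.hd' θ.hL' θ.b₀ θ.b₁ Mstar, M12 ≤ (geo9Y x).M → ∀ α₀ : ℝ, 0 < α₀ → (geo9Y x).M * α₀ ≤ a12 → ∀ U : (bg9YR (Matrix (Fin N) (Fin N) ℂ) (specialUnitaryUnits (Fin N)) R₁ R₂ x).Cfg, (bg9YR (Matrix (Fin N) (Fin N) ℂ) (specialUnitaryUnits (Fin N)) R₁ R₂ x).Reg335 c α₀ U →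
      (bg9YR (Matrix (Fin N) (Fin N) ℂ) (specialUnitaryUnits (Fin N)) R₁ R₂ x).Reg336 c α₀ U → ∀ ν : Fin (θ.d₆ + 1), HasMajorantHom (g := toB6 (geo9Y x) 1 (H12 x)) (𝔬12 x).blk (𝔬12 x).blk (Dd x U ν ∘ₗ (𝔬12 x).G0 U)
      (fun (a b : (geo9Y x).Site) => B12₀ * (geo9Y x).len a * Real.exp (-(δ12₀ * (geo9Y x).dist a b))))
    (h43d : ∀ x : MemberY θ.d₆ θ.ℓ₆ θ.hd' θ.hL' θ.b₀ θ.b₁ Mstar, M12 ≤ (geo9Y x).M → ∀ α₀ : ℝ, 0 < α₀ → (geo9Y x).M * α₀ ≤ a12 → ∀ U : (bg9YR (Matrix (Fin N) (Fin N) ℂ) (specialUnitaryUnits (Fin N)) R₁ R₂ x).Cfg, (bg9YR (Matrix (Fin N) (Fin N) ℂ) (specialUnitaryUnits (Fin N)) R₁ R₂ x).Reg335 c α₀ U →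
      (bg9YR (Matrix (Fin N) (Fin N) ℂ) (specialUnitaryUnits (Fin N)) R₁ R₂ x).Reg336 c α₀ U → ∀ (ν : Fin (θ.d₆ + 1)) (β : ℝ), 0 ≤ β → β < 1 →
      HasMajorantHom (g := toB6 (geo9Y x) 1 (H12 x)) (𝔬12 x).blk (𝔭A x).blkPX ((𝔭A x).ΦX U β ∘ₗ (Dd x U ν ∘ₗ (𝔬12 x).G0 U))
        (fun (a b : (geo9Y x).Site) => Bh12 β * (geo9Y x).len a ^ (1 - β) * Real.exp (-(δ12₀ * (geo9Y x).dist a b)))) :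
    ∃ (Md Bd : ℝ) (Bq : ℝ → ℝ), M12 ≤ Md ∧ 0 ≤ Bd ∧ (∀ β, 0 ≤ Bq β) ∧
      ∀ x : MemberY θ.d₆ θ.ℓ₆ θ.hd' θ.hL' θ.b₀ θ.b₁ Mstar, Md ≤ (geo9Y x).M → ∀ α₀ : ℝ, 0 < α₀ → (geo9Y x).M * α₀ ≤ a12 → ∀ U : (bg9YR (Matrix (Fin N) (Fin N) ℂ) (specialUnitaryUnits (Fin N)) R₁ R₂ x).Cfg, (bg9YR (Matrix (Fin N) (Fin N) ℂ) (specialUnitaryUnits (Fin N)) R₁ R₂ x).Reg335 c α₀ U → (bg9YR (Matrix (Fin N) (Fin N) ℂ) (specialUnitaryUnits (Fin N)) R₁ R₂ x).Reg336 c α₀ U →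
        (∀ ν : Fin (θ.d₆ + 1), HasMaj (weightNorm (BlockNorm.ofBlocks (toB6 (geo9Y x) 1 (H12 x)) (𝔬12 x).blkZ) (fun y => ((((θ.ℓ₆ + 1 : ℕ) : ℝ) ^ (θ.d₆ + 1)) ^ lvl x.hN x.D x.hk y)⁻¹) (fun y => (plateau_pos x.toKIdx y).le)) (cNorm 1 (H12 x) (𝔬12 x).blk (fun y => (geo9Y_len_pos x y).le) 1)
          (Dd x U ν ∘ₗ (𝔬12 x).G0 U ∘ₗ (𝔬12 x).Qstar U) (fun a b => Bd * Real.exp (-(δ12₃ * (geo9Y x).dist a b)))) ∧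
        (∀ (ν : Fin (θ.d₆ + 1)) (β : ℝ), 0 ≤ β → β < 1 →
          HasMaj (weightNorm (BlockNorm.ofBlocks (toB6 (geo9Y x) 1 (H12 x)) (𝔬12 x).blkZ) (fun y => ((((θ.ℓ₆ + 1 : ℕ) : ℝ) ^ (θ.d₆ + 1)) ^ lvl x.hN x.D x.hk y)⁻¹) (fun y => (plateau_pos x.toKIdx y).le)) (cNormR 1 (H12 x) (𝔭A x).blkPX (fun y => (geo9Y_len_pos x y).le) (β - 1))
            (((𝔭A x).ΦX U β ∘ₗ Dd x U ν ∘ₗ (𝔬12 x).G0 U) ∘ₗ (𝔬12 x).Qstar U) (fun a b => Bq β * Real.exp (-(δ12₃ * (geo9Y x).dist a b)))) := by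
  -- a [4] (2.61) row sum at rate σ12 (only its constant enters)
  obtain ⟨ML, cL, hrowL⟩ := rowSum261_geo9Y (d := θ.d₆) (ℓ := θ.ℓ₆) (hd := θ.hd') (hL := θ.hL') (b₀ := θ.b₀) (b₁ := θ.b₁) (Mstar := Mstar) σ12 hσ12
  have hrow : ∀ x : MemberY θ.d₆ θ.ℓ₆ θ.hd' θ.hL' θ.b₀ θ.b₁ Mstar, ML ≤ (geo9Y x).M → RowSum (toB6 (geo9Y x) 1 (H12 x)) σ12 (max cL 0) := fun x hM y => (hrowL x hM y).trans (le_max_left _ _)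
  have hc : (0 : ℝ) ≤ max cL 0 := le_max_right _ _
  refine ⟨max M12 ML, B12₀ * BQ * max cL 0, fun β => max (Bh12 β) 0 * BQ * max cL 0, le_max_left _ _, mul_nonneg (mul_nonneg hB12₀ hBQ) hc,
    fun β => mul_nonneg (mul_nonneg (le_max_right _ _) hBQ) hc, fun x hM α₀ hα ha U hU hU' => ?_⟩
  have hM12x : M12 ≤ (geo9Y x).M := (le_max_left _ _).trans hM
  have hMLx : ML ≤ (geo9Y x).M := (le_max_right _ _).trans hM
  have hG : GeoOK (geo9Y x) := ⟨geo9Y_dist_triangle x, geo9Y_dist_comm x, geo9K_dist_nonneg x.toKIdx, geo9Y_len_pos x⟩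
  have hqs := hqsK x hM12x α₀ hα ha U hU
  refine ⟨fun ν => dgQs_of_e1 hG (hrow x hMLx) hB12₀ hBQ hc hδ30 hδ₃₀ hδQ le_rfl (he1d x hM12x α₀ hα ha U hU hU' ν) hqs,
    fun ν β hβ hβ1 => ?_⟩
  have hBq : Bh12 β * BQ * max cL 0 ≤ max (Bh12 β) 0 * BQ * max cL 0 :=
    mul_le_mul_of_nonneg_right (mul_le_mul_of_nonneg_right (le_max_left _ _) hBQ) hc
  exact pQ_of_h43 hG (hrow x hMLx) (hBh12 β hβ hβ1) hBQ hc hδ30 hδ₃₀ hδQ hBq (h43d x hM12x α₀ hα ha U hU hU' ν β hβ hβ1) hqs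

end Summit.QuantumFields.YangMills.BalabanUVNodes.N06G0QstarLettersLegAtPinsPUPar

end
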